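import Literature.NumberTheory.Automorphic.Liu2021.AppendixC.HeckePushPullPackage
import HarnessLib

/-!
# The level package of ONE normal pair `N ≤ K` with HONEST coset representatives of `K ∕ N` (Liu 2021 §4.2 / App. C; Milne 2005 §5;
# Lang VIII §6)

Topic `NumberTheory/Automorphic/Liu2021/AppendixC`; namespace `Literature.NumberTheory.Automorphic.Liu2021.AppendixC`.
PROOF FILE (theorems only: no definition ∕ structure ∕ instance ∕ named fact ∕ `sorry`); a corollary leaf of ★ `HeckeTranslateLevelQuotient`
(`exists_act_isSepQuotient_map`, `isSepQuotient_quotientLift`) and ★ `AlbaneseTraceOfFiniteQuotientOfCocycle`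
(`Albanese.exists_trace_of_isSepQuotient_complex`).  Cell `hodgecm-mathlib` (D-0151), d6 `stub_RosH` glue, (C) «the whole second half at the
GS tower» (producer (S1), honest-representative form).  COUNT-NEUTRAL capital: HC_CM is proved only modulo the 7 printed citations until
rung 0 closes.

## What
★ `exists_levelPackage_inj` (faithful quotient) serves the (hx) side of the glue; the BRICK ★ `algEquiv_symm_endAlgebraBaseChange_heckeEnd_eq_smul_fan_sum_single`
(through ★ (N4′)) needs a system `δ : ι → G` of HONEST representatives of `K ∕ N` (`hsurjN`, `hinjN`) pinning the Albanese trace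
(`Alb_u ≫ t = Σ_i Alb T_{δ i}`).  Here, AT A GIVEN normal pair `N ≤ K` with the level-quotient universal property:

* `Sec42Data.HeckeTranslates.exists_levelPackage_reps` — the finite group `Δ = K ∕ N` acting on `X_N` by translates
  (`act : Δ →* Aut X_N`, NOT necessarily injective), honest representatives `δ d := (out d)⁻¹ ∈ K` with `act d = T_{δ d}`,
  `∀ k ∈ K, ∃ d, (δ d)⁻¹ k ∈ N`, `(δ d)⁻¹ δ d′ ∈ N → d = d′`, every `T_k` (`k ∈ K`) some `act d`, the Albanese trace
  `t : A_K → A_N` with `Alb_u ≫ t = Σ_d Alb(act d)` ([Lang1983AbelianVarieties] VIII §6 Thm. 13), and `u^N_K` a quotient of `X_N` by `act`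
  for separated test objects ([MumfordAV1970] §7 Remark; [Milne2005ShimuraVarieties] §5 «`Sh_K = Sh_{K′}/(K/K′)`»).

## References
* [Liu2021] Y. Liu, *Fourier–Jacobi cycles and arithmetic relative trace formula*, Camb. J. Math. 9 (2021); §4.2 (FJcycle.tex l. 2060–2074).
* [Milne2005ShimuraVarieties] J. S. Milne, *Introduction to Shimura varieties* (2005), §5 p. 57 L7–12, p. 58 L3–11, Rem. 5.29 (c) p. 65.
* [Lang1983AbelianVarieties] S. Lang, *Abelian Varieties* (1983), Ch. VIII §6 Thm. 13 (pp. 224–227).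
* [MumfordAV1970] D. Mumford, *Abelian Varieties* (1970), §7 Thm. p. 66 and Remark.
-/

set_option autoImplicit false

noncomputable section

open CategoryTheory AlgebraicGeometry NumberField
open Literature.AlgebraicGeometry.Motives

namespace Literature.NumberTheory.Automorphic.Liu2021.AppendixC

universe u v

section Sec42

variable {F E : Type} [Field F] [NumberField F] [IsTotallyReal F] [Field E] [NumberField E] [Algebra F E]
  [IsTotallyComplex E] [Algebra.IsQuadraticExtension F E]
variable {P5 : PropC5Data F E} {isotropicAt : ℕ → Prop}

namespace Sec42Data.HeckeTranslates

variable {C : Sec42Data P5 isotropicAt} (T : C.HeckeTranslates)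

/-- **THE LEVEL PACKAGE OF A NORMAL PAIR WITH HONEST REPRESENTATIVES.**  For `N ≤ K` with `N` normalised by `K` and the level-quotient
universal property of `u^N_K : X_N → X_K` w.r.t. the translates `T_k`, `k ∈ K`: the finite non-empty group `Δ = K ∕ N` acts on `X_N` by
translates, `act d = T_{δ d}` for the honest representatives `δ d := (out d)⁻¹ ∈ K` — every class of `K ∕ N` is some `δ d` up to `N`
(`∀ k ∈ K, ∃ d, (δ d)⁻¹ k ∈ N`) and distinct `d` give distinct classes (`(δ d)⁻¹ δ d′ ∈ N → d = d′`) —, every `T_k` (`k ∈ K`) is some `act d`,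
the Albanese trace `t : A_K → A_N` is pinned by `Alb_u ≫ t = Σ_d Alb(act d)` ([Lang1983AbelianVarieties] VIII §6 Thm. 13), and `u^N_K` is a
quotient of `X_N` by `act` for separated test objects.  (The group acts through `k ↦ T_{k⁻¹}`, ★ `exists_act_isSepQuotient_map`; `T_n = 𝟙` for
`n ∈ N`; `K ∕ N` is finite as `K` is compact and `N` open.) [cite: Milne2005ShimuraVarieties, §5 p. 57 L7–12, p. 58 L3–11 and Rem. 5.29 (c) p. 65]
[cite: Lang1983AbelianVarieties, Ch. VIII §6, Thm. 13 (pp. 224–227)] [cite: MumfordAV1970, §7 Thm. p. 66 (Remark)] -/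
theorem exists_levelPackage_reps (τ : E →+* ℂ) ⦃N K : C5.SmallLevel C.S.K₀⦄ (hNK : N ≤ K) (hn : ∀ k ∈ K.1.1, C5.HeckeLE k N N)
    (hUP : ∀ (W : SchemeOver E) (f : C.X N ⟶ W), IsSeparated W.hom →
      (∀ (k : C.G) (hk : k ∈ K.1.1), T.tr k N N (hn k hk) ≫ f = f) → ∃! fbar : C.X K ⟶ W, C.cpt.X.map (homOfLE hNK) ≫ fbar = f) :
    ∃ (Δ : Type) (_ : Group Δ) (_ : Fintype Δ) (_ : Nonempty Δ) (act : Δ →* Aut (C.X N))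
      (δ : Δ → C.G) (hδ : ∀ d, δ d ∈ K.1.1)
      (_ : ∀ d, (act d).hom = T.tr (δ d) N N (hn _ (hδ d)))
      (_ : ∀ k ∈ K.1.1, ∃ d, (δ d)⁻¹ * k ∈ N.1.1)
      (_ : ∀ d d', (δ d)⁻¹ * δ d' ∈ N.1.1 → d = d')
      (_ : ∀ (k : C.G) (hk : k ∈ K.1.1), ∃ d, (act d).hom = T.tr k N N (hn k hk))
      (t : C.A K ⟶ C.A N)
      (_ : (C.alb N).map (C.alb K) (C.cpt.X.map (homOfLE hNK)) ≫ t = ∑ d, (C.alb N).map (C.alb N) (act d).hom),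
      IsSepQuotient (fun d => act d) (C.cpt.X.map (homOfLE hNK)) := by
  classical
  obtain ⟨act₀, hact₀, hq₀⟩ := T.exists_act_isSepQuotient_map hNK hn hUP
  -- the finite quotient `K ∕ N`
  let Kg : Subgroup C.G := K.1.1
  let Ng : Subgroup ↥Kg := N.1.1.subgroupOf K.1.1
  have hmemNg : ∀ x : ↥Kg, x ∈ Ng ↔ (x : C.G) ∈ N.1.1 := fun x => Subgroup.mem_subgroupOf
  haveI hNn : Ng.Normal := ⟨fun n hn' g => by
    rw [hmemNg] at hn' ⊢
    have h1 := hn (g⁻¹ : ↥Kg) (g⁻¹).2 _ hn'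
    simpa only [Subgroup.coe_inv, inv_inv, Subgroup.coe_mul] using h1⟩
  haveI : CompactSpace ↥Kg := isCompact_iff_compactSpace.1 K.1.2.2
  have hNo : IsOpen (Ng : Set ↥Kg) := N.1.2.1.preimage continuous_subtype_val
  haveI : Finite (↥Kg ⧸ Ng) := Subgroup.quotient_finite_of_isOpen Ng hNo
  letI : Fintype (↥Kg ⧸ Ng) := Fintype.ofFinite _
  have hker : ∀ n ∈ Ng, act₀ n = 1 := fun n hn' => by
    apply Iso.ext
    rw [hact₀]
    change _ = 𝟙 _
    exact T.tr_self (K := N) (N.1.1.inv_mem ((hmemNg n).1 hn'))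
  let act : ↥Kg ⧸ Ng →* Aut (C.X N) := QuotientGroup.lift Ng act₀ hker
  have hactmk : ∀ k : ↥Kg, act (QuotientGroup.mk k) = act₀ k := fun k => QuotientGroup.lift_mk' Ng hker k
  have hq : IsSepQuotient (fun d => act d) (C.cpt.X.map (homOfLE hNK)) := isSepQuotient_quotientLift Ng act₀ hker hq₀
  -- honest representatives `δ d := (out d)⁻¹`
  let δ : ↥Kg ⧸ Ng → C.G := fun d => ((Quotient.out d : ↥Kg) : C.G)⁻¹
  have hδ : ∀ d, δ d ∈ K.1.1 := fun d => K.1.1.inv_mem (Quotient.out d).2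
  have hact : ∀ d, (act d).hom = T.tr (δ d) N N (hn _ (hδ d)) := fun d => by
    have hd : act d = act₀ (Quotient.out d) := by
      conv_lhs => rw [← QuotientGroup.out_eq' d]
      exact hactmk _
    rw [hd, hact₀]
  -- the Albanese trace on `Δ = K ∕ N` (Lang VIII §6 Thm. 13)
  letI : Algebra E ℂ := τ.toAlgebra
  haveI := C.cpt.smooth_X N
  haveI := C.cpt.smooth_X K
  obtain ⟨t, ht⟩ := Albanese.exists_trace_of_isSepQuotient_complex (dX := P5.n - 1) (dY := P5.n - 1) (C.cpt.projective_X N)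
    (C.cpt.projective_X K) act (C.cpt.X.map (homOfLE hNK)) hq (C.alb N) (C.alb K)
  refine ⟨↥Kg ⧸ Ng, inferInstance, inferInstance, ⟨1⟩, act, δ, hδ, hact, fun k hk => ?_, fun d d' hdd' => ?_, fun k hk => ?_, t, ht, hq⟩
  · -- every class is hit: `d := [k⁻¹]`, `out d = k⁻¹ n`, `(δ d)⁻¹ k = k⁻¹ n k ∈ N`
    obtain ⟨n', hn'⟩ := QuotientGroup.mk_out_eq_mul Ng (⟨k⁻¹, K.1.1.inv_mem hk⟩ : ↥Kg)
    refine ⟨QuotientGroup.mk ⟨k⁻¹, K.1.1.inv_mem hk⟩, ?_⟩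
    have e1 : (δ (QuotientGroup.mk ⟨k⁻¹, K.1.1.inv_mem hk⟩))⁻¹ * k = k⁻¹ * ((n' : ↥Kg) : C.G) * k := by
      change ((((Quotient.out _ : ↥Kg) : C.G)⁻¹)⁻¹) * k = _
      rw [inv_inv, hn', Subgroup.coe_mul, Subgroup.coe_mk]
    rw [e1]
    exact hn k hk _ ((hmemNg _).1 n'.2)
  · -- distinct classes: `out d * (out d′)⁻¹ ∈ N ⇒ (out d)⁻¹ * out d′ ∈ N ⇒ d = d′`
    have h1 : ((Quotient.out d : ↥Kg) : C.G) * ((Quotient.out d' : ↥Kg) : C.G)⁻¹ ∈ N.1.1 := by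
      have := hdd'
      change (((Quotient.out d : ↥Kg) : C.G)⁻¹)⁻¹ * ((Quotient.out d' : ↥Kg) : C.G)⁻¹ ∈ N.1.1 at this
      rwa [inv_inv] at this
    have h2 : ((Quotient.out d : ↥Kg) : C.G)⁻¹ * ((Quotient.out d' : ↥Kg) : C.G) ∈ N.1.1 := by
      -- conjugate `out d · (out d′)⁻¹` by `(out d′)⁻¹`, then invert
      have h3 := hn _ (Quotient.out d' : ↥Kg).2 _ h1
      have h4 : ((Quotient.out d' : ↥Kg) : C.G)⁻¹ * (((Quotient.out d : ↥Kg) : C.G) * ((Quotient.out d' : ↥Kg) : C.G)⁻¹) *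
          ((Quotient.out d' : ↥Kg) : C.G) = ((Quotient.out d' : ↥Kg) : C.G)⁻¹ * ((Quotient.out d : ↥Kg) : C.G) := by group
      rw [h4] at h3
      have h5 := N.1.1.inv_mem h3
      rwa [mul_inv_rev, inv_inv] at h5
    rw [← QuotientGroup.out_eq' d, ← QuotientGroup.out_eq' d']
    exact QuotientGroup.eq.mpr ((hmemNg _).2 (by simpa only [Subgroup.coe_mul, Subgroup.coe_inv] using h2))
  · -- every `T_k` occurs: `d := [k⁻¹]`
    refine ⟨QuotientGroup.mk ⟨k⁻¹, K.1.1.inv_mem hk⟩, ?_⟩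
    rw [hactmk, hact₀]
    exact T.tr_congr (by rw [Subgroup.coe_mk, inv_inv]) _ _

end Sec42Data.HeckeTranslates

end Sec42

end Literature.NumberTheory.Automorphic.Liu2021.AppendixC

end
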